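import Summits.NavierStokesRegularity.NavierStokesRegularity.Theorems.ExtremiserTransienceDissipationLedgerFarField
import Literature.Analysis.FluidPDE.NormalisedPressureL2Finite
import Literature.Analysis.FluidPDE.EnergyToolkit
import Literature.Analysis.FluidPDE.WholeSpaceIBP
import Literature.Analysis.FluidPDE.HeatDivFormGradientL2
import HarnessLib

/-!
# Dissipation ledger (LINE g10-α, crux 26567), stub L1 — the pressure flux of one slice under linear local-energy growth

Helper file for the registered stub `stub_dissipationBudget` (L1 `DissipationBudget`) of LINE g10-α `dissipation_ledger`
(crux `NearExtremalTransiencePerFlow`, stmt-NavierStokesRegularity-26567).  For one smooth velocity slice `v : ℝ³ → ℝ³` with a sup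
bound `‖v‖ ≤ N` and LINEAR LOCAL-ENERGY GROWTH about the origin `∫_{B(0,R)}‖v‖² ≤ A R`, and a cut-off `φ` with `tsupport φ ⊆ B̄(0,2)`
and `‖Dφ‖ ≤ C_φ`, the PRESSURE FLUX TERM of the local energy identity, with the pressure in the Riesz gauge
`Q̃ = pressurePotentialMod 0 v` (the gauge of every classical pressure of a bounded Oseen-mild field, tree
`pressure_eq_pressurePotentialMod_add_const_of_oseenMild`), obeys

  `∫ |Q̃(x)| ‖Dφ(x)‖ ‖v(x)‖ dx ≤ C_P · C_φ · (N·A + A·√A)`        (`pressureFlux_slice_le`, `C_P` absolute).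

The point is the budget: only ONE factor `N` (for a Type-I ancient field `N = K/√(−τ)`, integrable in time), the rest is the growth
constant `A`.  Mechanism (all inputs are tree theorems): on `B̄(0,2)`, `Q̃ = p̃[χ₄v] + Q₂[χ₄v] − (far part mod constants)`
(`pressurePotentialMod_eq_of_norm_le_two`: locality of the near potential `nearPotential_congr_of_eqOn_ball`, Tao's identity
`normalisedPressure_eq_pressurePotential` for the compactly supported localisation `χ₄v`), where `|Q₂[χ₄v]| ≤ M₀ ∫|χ₄v|² ≤ 9M₀A`
(`abs_farPotential_le`), the far part mod constants is `≤ C₀A` (`abs_farPotentialMod_le_of_growth`, the dyadic far-field sum), and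
Stein's `L²` bound `‖p̃[χ₄v]‖₂ ≤ 27M_λ ‖|χ₄v|²‖₂ ≤ 27M_λ·N·3√A` (`eLpNorm_normalisedPressure_le_of_integrable`) is paired with
`‖v‖_{L²(B̄(0,2))} ≤ √(5A)` by Cauchy–Schwarz.

HONEST FRAMING: an elementary potential-theoretic estimate; nothing about Navier–Stokes regularity or blow-up is proved; no summit is
proved by a line. [cite: Stein1971, Ch. II §4.2 Thm 3; GilbargTrudinger2001, (2.14)]
-/

noncomputable section

open MeasureTheory Set Filter Metric Topology Function
open scoped ENNReal NNReal

namespace Summit.NavierStokesRegularity.NavierStokesRegularity.Theorems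

set_option linter.dupNamespace false

namespace NearExtremalTransiencePerFlow.DissipationLedger

open Literature.Analysis.FluidPDE

-- nested operator types `E3 →L[ℝ] E3 →L[ℝ] ℝ`
set_option maxSynthPendingDepth 3

/-! ### The localisation `χ₄ v` -/

/-- `χ_R v = v` on the closed ball of radius `R`. [folklore] -/
theorem cutoff_smul_eq_self {R : ℝ} (hR : 0 < R) (v : EuclideanSpace ℝ (Fin 3) → EuclideanSpace ℝ (Fin 3))
    {y : EuclideanSpace ℝ (Fin 3)} (hy : ‖y‖ ≤ R) : cutoff R y • v y = v y := by
  rw [cutoff_eq_one hR hy, one_smul]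

/-- `χ_R v = 0` off the ball of radius `2R`. [folklore] -/
theorem cutoff_smul_eq_zero {R : ℝ} (hR : 0 < R) (v : EuclideanSpace ℝ (Fin 3) → EuclideanSpace ℝ (Fin 3))
    {y : EuclideanSpace ℝ (Fin 3)} (hy : 2 * R ≤ ‖y‖) : cutoff R y • v y = 0 := by
  rw [cutoff_eq_zero hR hy, zero_smul]


/-- `‖χ_R v‖²` has compact support (`R > 0`). [folklore] -/
theorem hasCompactSupport_norm_sq_cutoff_smul (v : EuclideanSpace ℝ (Fin 3) → EuclideanSpace ℝ (Fin 3)) {R : ℝ} (hR : 0 < R) :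
    HasCompactSupport fun y => ‖cutoff R y • v y‖ ^ 2 :=
  (hasCompactSupport_cutoff_smul (w := v) hR).norm.comp_left (g := fun r : ℝ => r ^ 2) (by simp)

/-- **The localisation spends at most the growth budget of one ball**: `∫ ‖χ₄ v‖² ≤ 9A` (support in `B(0,9)`, `|χ₄| ≤ 1`).
[folklore] -/
theorem integral_norm_sq_cutoff_smul_le {v : EuclideanSpace ℝ (Fin 3) → EuclideanSpace ℝ (Fin 3)} (hv : Continuous v)
    {R A : ℝ} (hR : 0 < R) (hA : ∀ ρ : ℝ, 0 < ρ → ∫ z in ball (0 : EuclideanSpace ℝ (Fin 3)) ρ, ‖v z‖ ^ 2 ≤ A * ρ) :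
    ∫ y, ‖cutoff R y • v y‖ ^ 2 ≤ A * (2 * R + 1) := by
  have h2R : 0 < 2 * R + 1 := by linarith
  -- the integrand vanishes off the ball `B(0, 2R+1)`
  have hzero : ∀ y ∉ ball (0 : EuclideanSpace ℝ (Fin 3)) (2 * R + 1), ‖cutoff R y • v y‖ ^ 2 = 0 := by
    intro y hy
    rw [mem_ball_zero_iff, not_lt] at hy
    rw [cutoff_smul_eq_zero hR v (by linarith), norm_zero, zero_pow two_ne_zero]
  rw [← setIntegral_eq_integral_of_forall_compl_eq_zero hzero]
  calc ∫ y in ball (0 : EuclideanSpace ℝ (Fin 3)) (2 * R + 1), ‖cutoff R y • v y‖ ^ 2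
      ≤ ∫ y in ball (0 : EuclideanSpace ℝ (Fin 3)) (2 * R + 1), ‖v y‖ ^ 2 := by
        refine setIntegral_mono_on ?_ (integrableOn_norm_sq_ball hv 0 _) measurableSet_ball fun y _ => ?_
        · exact (integrableOn_norm_sq_ball ((contDiff_cutoff (n := 0) R).continuous.smul hv) 0 _)
        · exact pow_le_pow_left₀ (norm_nonneg _) (norm_cutoff_smul_le (w := v) R y) 2
    _ ≤ A * (2 * R + 1) := hA _ h2R

/-! ### The Riesz gauge on `B̄(0,2)`: near part = Tao's normalised pressure of the localisation -/

/-- **The Riesz pressure modulo constants on `B̄(0,2)`, decomposed**: for `v ∈ C^∞` and `|x| ≤ 2`,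
`Q̃(x) = p̃[χ₄v](x) + Q₂[χ₄v](x) − farPotentialMod 1 2 0 v x` — the near potential only sees `v` on `B(x,2) ⊆ B̄(0,4)` where
`χ₄ = 1` (`nearPotential_congr_of_eqOn_ball`), and for the compactly supported `χ₄v` one has `−Q₁ = Q + Q₂` with `Q = p̃` (Tao 2011
(35), tree `normalisedPressure_eq_pressurePotential`). [cite: Tao2011, (35) and (42)] -/
theorem pressurePotentialMod_eq_of_norm_le_two {v : EuclideanSpace ℝ (Fin 3) → EuclideanSpace ℝ (Fin 3)}
    (hv : ContDiff ℝ (⊤ : ℕ∞) v) {x : EuclideanSpace ℝ (Fin 3)} (hx : ‖x‖ ≤ 2) :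
    pressurePotentialMod 0 v x =
      normalisedPressure (fun y => cutoff 4 y • v y) x + farPotential 1 2 (fun y => cutoff 4 y • v y) x -
        farPotentialMod 1 2 0 v x := by
  set u : EuclideanSpace ℝ (Fin 3) → EuclideanSpace ℝ (Fin 3) := fun y => cutoff 4 y • v y with hu
  have hu2 : ContDiff ℝ 2 u := (contDiff_cutoff_smul hv 4).of_le (by norm_cast)
  have huc : HasCompactSupport u := hasCompactSupport_cutoff_smul (w := v) (by norm_num : (0 : ℝ) < 4)
  have hL2 : Integrable fun y => ‖u y‖ ^ 2 :=
    ((contDiff_cutoff_smul hv 4).continuous.norm.pow 2).integrable_of_hasCompactSupport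
      (hasCompactSupport_norm_sq_cutoff_smul v (by norm_num : (0 : ℝ) < 4))
  -- locality of the near potential
  have hnear : nearPotential 1 2 v x = nearPotential 1 2 u x := by
    refine nearPotential_congr_of_eqOn_ball fun y hy => ?_
    rw [mem_ball, dist_eq_norm] at hy
    have hy4 : ‖y‖ ≤ 4 := by
      have := norm_sub_norm_le y x
      linarith
    show v y = cutoff 4 y • v y
    rw [cutoff_smul_eq_self (by norm_num) v hy4]
  have htao : normalisedPressure u x = pressurePotential u x := normalisedPressure_eq_pressurePotential hu2 hL2 x
  unfold pressurePotentialMod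
  rw [hnear, htao]
  unfold pressurePotential
  ring

/-- **Pointwise bound of the Riesz gauge on `B̄(0,2)` by the localised normalised pressure plus the budget**: there is an absolute
`D ≥ 0` with `|Q̃(x)| ≤ |p̃[χ₄v](x)| + D·A` for `|x| ≤ 2`, every `v ∈ C^∞` with linear growth `A` about `0`
(`|Q₂[χ₄v]| ≤ M₀ · 9A`, `|far part mod constants| ≤ C₀ A`). [cite: GilbargTrudinger2001, (2.14)] -/
theorem abs_pressurePotentialMod_le_of_norm_le_two :
    ∃ D : ℝ, 0 ≤ D ∧ ∀ (v : EuclideanSpace ℝ (Fin 3) → EuclideanSpace ℝ (Fin 3)), ContDiff ℝ (⊤ : ℕ∞) v → ∀ A : ℝ,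
      (∀ R : ℝ, 0 < R → ∫ z in ball (0 : EuclideanSpace ℝ (Fin 3)) R, ‖v z‖ ^ 2 ≤ A * R) →
      ∀ x : EuclideanSpace ℝ (Fin 3), ‖x‖ ≤ 2 →
        |pressurePotentialMod 0 v x| ≤ |normalisedPressure (fun y => cutoff 4 y • v y) x| + D * A := by
  obtain ⟨M₀, M₁, M₂, hM₀, -, -⟩ := exists_bounds_fderiv2_newtonFar one_pos one_lt_two
  obtain ⟨C₀, hC₀, hfar⟩ := abs_farPotentialMod_le_of_growth
  have hM₀0 : 0 ≤ M₀ := (norm_nonneg _).trans (hM₀ 0)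
  refine ⟨M₀ * 9 + C₀, by positivity, fun v hv A hA x hx => ?_⟩
  have hA0 : 0 ≤ A := growth_const_nonneg hA
  set u : EuclideanSpace ℝ (Fin 3) → EuclideanSpace ℝ (Fin 3) := fun y => cutoff 4 y • v y with hu
  have huc : HasCompactSupport u := hasCompactSupport_cutoff_smul (w := v) (by norm_num : (0 : ℝ) < 4)
  have hL2 : Integrable fun y => ‖u y‖ ^ 2 :=
    ((contDiff_cutoff_smul hv 4).continuous.norm.pow 2).integrable_of_hasCompactSupport
      (hasCompactSupport_norm_sq_cutoff_smul v (by norm_num : (0 : ℝ) < 4))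
  have hQ2 : |farPotential 1 2 u x| ≤ M₀ * (A * (2 * 4 + 1)) :=
    (abs_farPotential_le hL2 hM₀ x).trans
      (mul_le_mul_of_nonneg_left (integral_norm_sq_cutoff_smul_le hv.continuous (by norm_num) hA) hM₀0)
  have hF : |farPotentialMod 1 2 0 v x| ≤ C₀ * A := hfar v hv.continuous A hA x hx
  rw [pressurePotentialMod_eq_of_norm_le_two hv hx]
  calc |normalisedPressure u x + farPotential 1 2 u x - farPotentialMod 1 2 0 v x|
      ≤ |normalisedPressure u x + farPotential 1 2 u x| + |farPotentialMod 1 2 0 v x| := abs_sub _ _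
    _ ≤ |normalisedPressure u x| + |farPotential 1 2 u x| + |farPotentialMod 1 2 0 v x| := by
        gcongr; exact abs_add_le _ _
    _ ≤ |normalisedPressure u x| + M₀ * (A * (2 * 4 + 1)) + C₀ * A := by gcongr
    _ = |normalisedPressure u x| + (M₀ * 9 + C₀) * A := by ring

/-! ### `L²` facts -/

/-- **Stein's `L²` bound for the localised normalised pressure, in budget form**: `p̃[χ₄v] ∈ L²` with
`√(∫ |p̃[χ₄v]|²) ≤ 27 M_λ · N · √(9A)` when `‖v‖ ≤ N` and `v` has linear growth `A` about `0`
(`‖|χ₄v|²‖₂ ≤ N ‖χ₄v‖₂ ≤ N√(9A)`). [cite: Stein1971, Ch. II §4.2 Thm 3] -/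
theorem memLp_normalisedPressure_cutoff_smul {v : EuclideanSpace ℝ (Fin 3) → EuclideanSpace ℝ (Fin 3)}
    (hv : ContDiff ℝ (⊤ : ℕ∞) v) {N A : ℝ} (hN : ∀ y, ‖v y‖ ≤ N)
    (hA : ∀ R : ℝ, 0 < R → ∫ z in ball (0 : EuclideanSpace ℝ (Fin 3)) R, ‖v z‖ ^ 2 ≤ A * R) :
    MemLp (normalisedPressure fun y => cutoff 4 y • v y) 2 volume ∧
      Real.sqrt (∫ x, ‖normalisedPressure (fun y => cutoff 4 y • v y) x‖ ^ 2) ≤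
        27 * regLaplacianMass * N * Real.sqrt (A * 9) := by
  set u : EuclideanSpace ℝ (Fin 3) → EuclideanSpace ℝ (Fin 3) := fun y => cutoff 4 y • v y with hu
  have hA0 : 0 ≤ A := growth_const_nonneg hA
  have hN0 : 0 ≤ N := (norm_nonneg _).trans (hN 0)
  have huinf : ContDiff ℝ (⊤ : ℕ∞) u := contDiff_cutoff_smul hv 4
  have huc : HasCompactSupport u := hasCompactSupport_cutoff_smul (w := v) (by norm_num : (0 : ℝ) < 4)
  have hucont : Continuous u := huinf.continuous
  have hL2 : Integrable fun y => ‖u y‖ ^ 2 := (hucont.norm.pow 2).integrable_of_hasCompactSupport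
    (hasCompactSupport_norm_sq_cutoff_smul v (by norm_num : (0 : ℝ) < 4))
  -- `u ∈ L²`, `|u|² ∈ L²`
  have hu2 : MemLp u 2 volume := hucont.memLp_of_hasCompactSupport huc
  have husq2 : MemLp (fun y => ‖u y‖ ^ 2) 2 volume :=
    (hucont.norm.pow 2).memLp_of_hasCompactSupport (hasCompactSupport_norm_sq_cutoff_smul v (by norm_num : (0 : ℝ) < 4))
  -- pointwise `‖|u|²‖ ≤ N ‖u‖`
  have hptw : ∀ᵐ y ∂(volume : Measure (EuclideanSpace ℝ (Fin 3))), ‖‖u y‖ ^ 2‖ ≤ N * ‖u y‖ := by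
    refine ae_of_all _ fun y => ?_
    rw [Real.norm_of_nonneg (sq_nonneg _), sq]
    exact mul_le_mul_of_nonneg_right ((norm_cutoff_smul_le (w := v) 4 y).trans (hN y)) (norm_nonneg _)
  have hsq_le : eLpNorm (fun y => ‖u y‖ ^ 2) 2 volume ≤ ENNReal.ofReal N * eLpNorm u 2 volume :=
    eLpNorm_le_mul_eLpNorm_of_ae_le_mul hptw 2
  -- Stein
  have hstein := eLpNorm_normalisedPressure_le_of_integrable huinf hL2
  have hfin : eLpNorm (normalisedPressure u) 2 volume < ⊤ :=
    lt_of_le_of_lt hstein (ENNReal.mul_lt_top ENNReal.ofReal_lt_top husq2.eLpNorm_lt_top)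
  have hmem : MemLp (normalisedPressure u) 2 volume :=
    ⟨aestronglyMeasurable_normalisedPressure_of_integrable huinf hL2, hfin⟩
  refine ⟨hmem, ?_⟩
  -- assemble the real bound
  have hM : 0 ≤ regLaplacianMass := regLaplacianMass_nonneg
  rw [← HeatDivForm.toReal_eLpNorm_two_eq_sqrt hmem]
  have h1 : (eLpNorm (normalisedPressure u) 2 volume).toReal ≤
      (ENNReal.ofReal (27 * regLaplacianMass) * (ENNReal.ofReal N * eLpNorm u 2 volume)).toReal := by
    refine ENNReal.toReal_mono (ENNReal.mul_ne_top ENNReal.ofReal_ne_top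
      (ENNReal.mul_ne_top ENNReal.ofReal_ne_top hu2.eLpNorm_ne_top)) ?_
    exact hstein.trans (by gcongr)
  refine h1.trans ?_
  rw [ENNReal.toReal_mul, ENNReal.toReal_mul, ENNReal.toReal_ofReal (by positivity), ENNReal.toReal_ofReal hN0,
    HeatDivForm.toReal_eLpNorm_two_eq_sqrt hu2]
  have hu9 : Real.sqrt (∫ y, ‖u y‖ ^ 2) ≤ Real.sqrt (A * 9) := by
    refine Real.sqrt_le_sqrt ?_
    have := integral_norm_sq_cutoff_smul_le hv.continuous (by norm_num : (0 : ℝ) < 4) hA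
    norm_num at this
    linarith
  calc 27 * regLaplacianMass * (N * Real.sqrt (∫ y, ‖u y‖ ^ 2))
      ≤ 27 * regLaplacianMass * (N * Real.sqrt (A * 9)) := by gcongr
    _ = 27 * regLaplacianMass * N * Real.sqrt (A * 9) := by ring

/-! ### The pressure flux of one slice -/

/-- **The pressure flux term of the local energy identity, for one slice, is controlled by the sup norm (once) and the growth budget**:
there is an absolute `C_P ≥ 0` such that for every `v ∈ C^∞(ℝ³;ℝ³)` with `‖v‖ ≤ N` and `∫_{B(0,R)}‖v‖² ≤ A R` (`R > 0`), and every
function `φ` with `tsupport φ ⊆ B̄(0,2)` and `‖Dφ‖ ≤ C_φ`,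
`∫ |pressurePotentialMod 0 v x| · ‖Dφ(x)‖ · ‖v x‖ dx ≤ C_P · C_φ · (N·A + A·√A)`.
[cite: Stein1971, Ch. II §4.2 Thm 3] -/
theorem pressureFlux_slice_le :
    ∃ C_P : ℝ, 0 ≤ C_P ∧ ∀ (v : EuclideanSpace ℝ (Fin 3) → EuclideanSpace ℝ (Fin 3)), ContDiff ℝ (⊤ : ℕ∞) v →
      ∀ (N A : ℝ), (∀ y, ‖v y‖ ≤ N) →
      (∀ R : ℝ, 0 < R → ∫ z in ball (0 : EuclideanSpace ℝ (Fin 3)) R, ‖v z‖ ^ 2 ≤ A * R) →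
      ∀ (φ : EuclideanSpace ℝ (Fin 3) → ℝ) (Cφ : ℝ), tsupport φ ⊆ closedBall (0 : EuclideanSpace ℝ (Fin 3)) 2 →
      (∀ x, ‖fderiv ℝ φ x‖ ≤ Cφ) →
        ∫ x, |pressurePotentialMod 0 v x| * ‖fderiv ℝ φ x‖ * ‖v x‖ ≤ C_P * Cφ * (N * A + A * Real.sqrt A) := by
  obtain ⟨D, hD0, hD⟩ := abs_pressurePotentialMod_le_of_norm_le_two
  -- the volume of the ball `B(0,5)` (finite) enters the `L¹` bound of `χ₂ v`
  set V : ℝ := (volume (ball (0 : EuclideanSpace ℝ (Fin 3)) 5)).toReal with hV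
  have hV0 : 0 ≤ V := ENNReal.toReal_nonneg
  refine ⟨27 * regLaplacianMass * 3 * Real.sqrt 5 + D * Real.sqrt V * Real.sqrt 5, by
    have := regLaplacianMass_nonneg; positivity, ?_⟩
  intro v hv N A hN hA φ Cφ hφs hφD
  have hA0 : 0 ≤ A := growth_const_nonneg hA
  have hN0 : 0 ≤ N := (norm_nonneg _).trans (hN 0)
  have hCφ0 : 0 ≤ Cφ := (norm_nonneg _).trans (hφD 0)
  have hM : 0 ≤ regLaplacianMass := regLaplacianMass_nonneg
  set u : EuclideanSpace ℝ (Fin 3) → EuclideanSpace ℝ (Fin 3) := fun y => cutoff 4 y • v y with hu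
  -- the `L²` envelope `w = χ₂ v` of `v` on `B̄(0,2)`
  set w : EuclideanSpace ℝ (Fin 3) → EuclideanSpace ℝ (Fin 3) := fun y => cutoff 2 y • v y with hw
  have hwcont : Continuous w := (contDiff_cutoff_smul hv 2).continuous
  have hwc : HasCompactSupport w := hasCompactSupport_cutoff_smul (w := v) (by norm_num : (0 : ℝ) < 2)
  have hw2 : MemLp w 2 volume := hwcont.memLp_of_hasCompactSupport hwc
  have hwint : ∫ y, ‖w y‖ ^ 2 ≤ A * 5 := by
    have := integral_norm_sq_cutoff_smul_le hv.continuous (by norm_num : (0 : ℝ) < 2) hA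
    norm_num at this; linarith
  obtain ⟨hPmem, hPle⟩ := memLp_normalisedPressure_cutoff_smul hv hN hA
  -- the dominating integrand
  set g : EuclideanSpace ℝ (Fin 3) → ℝ := fun x =>
    Cφ * (‖normalisedPressure u x‖ * ‖w x‖) + Cφ * (D * A) * ‖w x‖ with hg
  -- integrability of the dominator
  have hI1 : Integrable fun x => ‖normalisedPressure u x‖ * ‖w x‖ := by
    have h := (hw2.norm).mul' (hPmem.norm) (r := 1)
    rw [memLp_one_iff_integrable] at h
    simpa only [norm_norm] using h
  have hwL1 : Integrable fun x => ‖w x‖ := (hwcont.norm).integrable_of_hasCompactSupport hwc.norm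
  have hgint : Integrable g := ((hI1.const_mul Cφ).add (hwL1.const_mul (Cφ * (D * A))))
  -- pointwise domination
  have hdom : ∀ x, |pressurePotentialMod 0 v x| * ‖fderiv ℝ φ x‖ * ‖v x‖ ≤ g x := by
    intro x
    by_cases hx : x ∈ tsupport φ
    · have hx2 : ‖x‖ ≤ 2 := by simpa [mem_closedBall, dist_zero_right] using hφs hx
      have hwx : w x = v x := cutoff_smul_eq_self (by norm_num) v hx2
      have h1 := hD v hv A hA x hx2
      have h2 : ‖fderiv ℝ φ x‖ ≤ Cφ := hφD x
      rw [hg]; dsimp only; rw [hwx, Real.norm_eq_abs]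
      have h3 : |pressurePotentialMod 0 v x| * ‖fderiv ℝ φ x‖ * ‖v x‖ ≤
          (|normalisedPressure u x| + D * A) * Cφ * ‖v x‖ := by
        gcongr
      refine h3.trans (le_of_eq ?_)
      ring
    · have h0 : fderiv ℝ φ x = 0 := fderiv_of_notMem_tsupport ℝ hx
      rw [h0, norm_zero, mul_zero, zero_mul, hg]
      positivity
  have hnn : 0 ≤ᵐ[volume] fun x => |pressurePotentialMod 0 v x| * ‖fderiv ℝ φ x‖ * ‖v x‖ :=
    ae_of_all _ fun x => by positivity
  refine (integral_mono_of_nonneg hnn hgint (ae_of_all _ hdom)).trans ?_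
  -- evaluate `∫ g`
  have hsplit : ∫ x, g x = Cφ * (∫ x, ‖normalisedPressure u x‖ * ‖w x‖) + Cφ * (D * A) * (∫ x, ‖w x‖) := by
    rw [hg]
    show ∫ x, (Cφ * (‖normalisedPressure u x‖ * ‖w x‖) + Cφ * (D * A) * ‖w x‖) = _
    rw [integral_add (hI1.const_mul Cφ) (hwL1.const_mul _), integral_const_mul, integral_const_mul]
  rw [hsplit]
  -- Cauchy–Schwarz twice
  have hCS1 : ∫ x, ‖normalisedPressure u x‖ * ‖w x‖ ≤ 27 * regLaplacianMass * N * Real.sqrt (A * 9) * Real.sqrt (A * 5) := by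
    refine (integral_norm_mul_norm_le_sqrt_mul_sqrt hPmem hw2).trans ?_
    exact mul_le_mul hPle (Real.sqrt_le_sqrt hwint) (Real.sqrt_nonneg _) (by positivity)
  have hone : MemLp (fun x : EuclideanSpace ℝ (Fin 3) => (ball (0 : EuclideanSpace ℝ (Fin 3)) 5).indicator (fun _ => (1 : ℝ)) x)
      2 volume := memLp_indicator_const 2 measurableSet_ball 1 (Or.inr measure_ball_lt_top.ne)
  have hCS2 : ∫ x, ‖w x‖ ≤ Real.sqrt (A * 5) * Real.sqrt V := by
    have hw_eq : ∀ x, ‖w x‖ = ‖w x‖ * ‖(ball (0 : EuclideanSpace ℝ (Fin 3)) 5).indicator (fun _ => (1 : ℝ)) x‖ := by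
      intro x
      by_cases hx : x ∈ ball (0 : EuclideanSpace ℝ (Fin 3)) 5
      · rw [indicator_of_mem hx, norm_one, mul_one]
      · rw [mem_ball_zero_iff, not_lt] at hx
        have : w x = 0 := cutoff_smul_eq_zero (by norm_num) v (by linarith)
        rw [this, norm_zero, zero_mul]
    calc ∫ x, ‖w x‖ = ∫ x, ‖w x‖ * ‖(ball (0 : EuclideanSpace ℝ (Fin 3)) 5).indicator (fun _ => (1 : ℝ)) x‖ :=
          integral_congr_ae (Eventually.of_forall hw_eq)
      _ ≤ Real.sqrt (∫ x, ‖w x‖ ^ 2) *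
            Real.sqrt (∫ x, ‖(ball (0 : EuclideanSpace ℝ (Fin 3)) 5).indicator (fun _ => (1 : ℝ)) x‖ ^ 2) :=
          integral_norm_mul_norm_le_sqrt_mul_sqrt hw2 hone
      _ = Real.sqrt (∫ x, ‖w x‖ ^ 2) * Real.sqrt V := by
          congr 2
          have : (fun x => ‖(ball (0 : EuclideanSpace ℝ (Fin 3)) 5).indicator (fun _ => (1 : ℝ)) x‖ ^ 2) =
              (ball (0 : EuclideanSpace ℝ (Fin 3)) 5).indicator (fun _ => (1 : ℝ)) := by
            funext x
            by_cases hx : x ∈ ball (0 : EuclideanSpace ℝ (Fin 3)) 5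
            · simp [indicator_of_mem hx]
            · simp [indicator_of_notMem hx]
          rw [this, integral_indicator measurableSet_ball, setIntegral_const, smul_eq_mul, mul_one, hV,
            Measure.real]
      _ ≤ Real.sqrt (A * 5) * Real.sqrt V := by gcongr
  -- final arithmetic
  have hs9 : Real.sqrt (A * 9) = 3 * Real.sqrt A := by
    rw [Real.sqrt_mul hA0, show Real.sqrt 9 = 3 by rw [show (9 : ℝ) = 3 ^ 2 by norm_num, Real.sqrt_sq (by norm_num)]]
    ring
  have hs5 : Real.sqrt (A * 5) = Real.sqrt A * Real.sqrt 5 := Real.sqrt_mul hA0 5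
  have hAA : Real.sqrt A * Real.sqrt A = A := Real.mul_self_sqrt hA0
  calc Cφ * (∫ x, ‖normalisedPressure u x‖ * ‖w x‖) + Cφ * (D * A) * (∫ x, ‖w x‖)
      ≤ Cφ * (27 * regLaplacianMass * N * Real.sqrt (A * 9) * Real.sqrt (A * 5)) +
          Cφ * (D * A) * (Real.sqrt (A * 5) * Real.sqrt V) := by gcongr
    _ = (27 * regLaplacianMass * 3 * Real.sqrt 5) * Cφ * (N * (Real.sqrt A * Real.sqrt A)) +
          (D * Real.sqrt V * Real.sqrt 5) * Cφ * (A * Real.sqrt A) := by rw [hs9, hs5]; ring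
    _ = (27 * regLaplacianMass * 3 * Real.sqrt 5) * Cφ * (N * A) +
          (D * Real.sqrt V * Real.sqrt 5) * Cφ * (A * Real.sqrt A) := by rw [hAA]
    _ ≤ (27 * regLaplacianMass * 3 * Real.sqrt 5) * Cφ * (N * A + A * Real.sqrt A) +
          (D * Real.sqrt V * Real.sqrt 5) * Cφ * (N * A + A * Real.sqrt A) := by
        gcongr
        · exact le_add_of_nonneg_right (by positivity)
        · exact le_add_of_nonneg_left (by positivity)
    _ = (27 * regLaplacianMass * 3 * Real.sqrt 5 + D * Real.sqrt V * Real.sqrt 5) * Cφ * (N * A + A * Real.sqrt A) := by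
        ring

end NearExtremalTransiencePerFlow.DissipationLedger

end Summit.NavierStokesRegularity.NavierStokesRegularity.Theorems

end
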